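import Literature.Geometry.Manifold.ModelChange
import Mathlib.Geometry.Manifold.MFDeriv.Basic
import HarnessLib

/-!
# Change of model space: the differential of the identity `M ≃ Rechart f M`

Companion of `ModelChange.lean` (`Rechart f M`: the atlas of a charted space `M` (model with
corners `I` on `E`, model space `H`) transported along a homeomorphism of models `f : H ≃ₜ E'`;
`Rechart.into`, `Rechart.out` the identity maps, `C^n` both ways when `f` is the homeomorphism
underlying a continuous linear isomorphism `L : E ≃L[𝕜] E'` read through `I`, i.e.
`f x = L (I x)`).  For such a LINEAR change of model this file computes the differentials of
the identity maps:

* `Rechart.writtenInExtChartAt_into_eventuallyEq` — in the charts `c` at `x` and `f ∘ c` at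
  `into x` the identity `into` reads `L` near the base point (within `range I`);
  `Rechart.hasMFDerivWithinAt_into`, **`Rechart.hasMFDerivAt_into`**, `Rechart.mfderiv_into` —
  `d(into)_x = L`;
* `Rechart.writtenInExtChartAt_out_eventuallyEq`, **`Rechart.hasMFDerivAt_out`**,
  `Rechart.mfderiv_out` — `d(out)_p = L.symm`.

This is the bookkeeping that transports tangent vectors, vector fields and differential forms
between a product manifold `M × M'` (charted on `ModelProd H H'`) and its recharting on a single
normed model, where constructions available only for `𝓘(𝕜, E')`-manifolds (flow boxes, orbit
spaces of free circle actions) are performed (cf. the tree's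
`Literature.Topology.FourManifolds.Recharted.hasMFDerivAt_of`, the special case `H = E`,
`I = 𝓘(ℝ, E)`).  Everything is proved; no definitions, no facts.

## References

* J. M. Lee, *Introduction to Smooth Manifolds*, 2nd ed. (2013), Prop. 1.17, Prop. 3.6
  (differentials in coordinates). [LeeSmoothManifolds2013]
-/

noncomputable section

open scoped Manifold ContDiff Topology
open Set Function Filter

namespace Literature.Geometry.Manifold

namespace Rechart

variable {𝕜 : Type*} [NontriviallyNormedField 𝕜]
  {E : Type*} [NormedAddCommGroup E] [NormedSpace 𝕜 E] {H : Type*} [TopologicalSpace H]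
  {I : ModelWithCorners 𝕜 E H}
  {E' : Type*} [NormedAddCommGroup E'] [NormedSpace 𝕜 E']
  (f : H ≃ₜ E') (M : Type*) [TopologicalSpace M] [ChartedSpace H M]
  (L : E ≃L[𝕜] E')

/-- The extended chart of `Rechart f M` at `p` as a map: `f ∘ c ∘ out`, `c` the chart of `M` at
`out p`. [folklore] -/
theorem extChartAt_coe (p : Rechart f M) :
    ⇑(extChartAt 𝓘(𝕜, E') p) = f ∘ chartAt H (Rechart.out f M p) ∘ Rechart.out f M := by
  ext y
  simp [extChartAt, chartAt_def]

/-- The inverse extended chart of `Rechart f M` at `p` as a map: `into ∘ c.symm ∘ f.symm`.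
[folklore] -/
theorem extChartAt_symm_coe (p : Rechart f M) :
    ⇑(extChartAt 𝓘(𝕜, E') p).symm =
      Rechart.into f M ∘ (chartAt H (Rechart.out f M p)).symm ∘ f.symm := by
  ext y
  simp [extChartAt, chartAt_def]

/-- For a linear change of model, `f.symm y` read through `I` is `L.symm y`. [folklore] -/
theorem apply_symm_eq (hIf : ∀ x, f x = L (I x)) (y : E') : I (f.symm y) = L.symm y :=
  Literature.Topology.FourManifolds.Homeomorph.symm_apply_eq_linear f L
    (fun x ↦ by rw [modelWithCornersSelf_coe, id_eq]; exact hIf x) y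

/-- For a linear change of model, `range I` is all of `E` read through `L`: every `L.symm y` is
in `range I`. [folklore] -/
theorem symm_mem_range (hIf : ∀ x, f x = L (I x)) (y : E') : L.symm y ∈ range I :=
  ⟨f.symm y, apply_symm_eq f L hIf y⟩

/-- **The identity `into : M → Rechart f M` reads `L` in charts**: in the extended charts at `x`
and at `into x`, near the base point and within `range I`, `into` is `u ↦ L u`. [folklore] -/
theorem writtenInExtChartAt_into_eventuallyEq (hIf : ∀ x, f x = L (I x)) (x : M) :
    writtenInExtChartAt I 𝓘(𝕜, E') x (Rechart.into f M)
      =ᶠ[𝓝[range I] (extChartAt I x x)] (L : E → E') := by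
  have ht : (extChartAt I x).target ∈ 𝓝[range I] (extChartAt I x x) :=
    extChartAt_target_mem_nhdsWithin x
  filter_upwards [ht] with u hu
  have hu2 : (∃ y, I y = u) ∧ I.symm u ∈ (chartAt H x).target := by
    simpa [extChartAt] using hu
  have hu' : I.symm u ∈ (chartAt H x).target := hu2.2
  have huI : u ∈ range I := extChartAt_target_subset_range x hu
  simp only [writtenInExtChartAt, comp_apply, extChartAt_coe f M]
  rw [show Rechart.out f M (Rechart.into f M ((extChartAt I x).symm u)) = (extChartAt I x).symm u
    from rfl]
  simp only [extChartAt, OpenPartialHomeomorph.extend_coe_symm, comp_apply]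
  show f ((chartAt H x) ((chartAt H x).symm (I.symm u))) = L u
  rw [(chartAt H x).right_inv hu', hIf, I.right_inv huI]

/-- **`d(into)_x = L`** within `range I` in charts: `HasMFDerivAt` form. [folklore] -/
theorem hasMFDerivAt_into [IsManifold I 1 M] (hIf : ∀ x, f x = L (I x)) (x : M) :
    HasMFDerivAt I 𝓘(𝕜, E') (Rechart.into f M) x (L : E →L[𝕜] E') := by
  refine ⟨(continuous_into f M).continuousAt, ?_⟩
  have hev := writtenInExtChartAt_into_eventuallyEq f M L hIf x
  have hL : HasFDerivWithinAt (L : E → E') (L : E →L[𝕜] E') (range I) (extChartAt I x x) :=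
    (L : E →L[𝕜] E').hasFDerivAt.hasFDerivWithinAt
  refine hL.congr_of_eventuallyEq hev ?_
  -- value at the base point
  have h0 : writtenInExtChartAt I 𝓘(𝕜, E') x (Rechart.into f M) (extChartAt I x x) =
      L (extChartAt I x x) := by
    simp only [writtenInExtChartAt, comp_apply, extChartAt_to_inv, extChartAt_coe f M]
    show f (chartAt H x x) = L (extChartAt I x x)
    rw [hIf]
    rfl
  exact h0

/-- `mfderiv` of the identity `into` is `L`. [folklore] -/
theorem mfderiv_into [IsManifold I 1 M] (hIf : ∀ x, f x = L (I x)) (x : M) :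
    mfderiv I 𝓘(𝕜, E') (Rechart.into f M) x = (L : E →L[𝕜] E') :=
  (hasMFDerivAt_into f M L hIf x).mfderiv

/-- **The identity `out : Rechart f M → M` reads `L.symm` in charts**: in the extended charts at
`p` and at `out p`, near the base point, `out` is `y ↦ L.symm y`. [folklore] -/
theorem writtenInExtChartAt_out_eventuallyEq (hIf : ∀ x, f x = L (I x)) (p : Rechart f M) :
    writtenInExtChartAt 𝓘(𝕜, E') I p (Rechart.out f M)
      =ᶠ[𝓝 (extChartAt 𝓘(𝕜, E') p p)] (L.symm : E' → E) := by
  set c := chartAt H (Rechart.out f M p) with hc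
  have ht : (extChartAt 𝓘(𝕜, E') p).target ∈ 𝓝 (extChartAt 𝓘(𝕜, E') p p) := by
    have h := extChartAt_target_mem_nhdsWithin (I := 𝓘(𝕜, E')) p
    rwa [modelWithCornersSelf_coe, range_id, nhdsWithin_univ] at h
  filter_upwards [ht] with y hy
  have hy' : f.symm y ∈ c.target := by
    simpa [extChartAt, chartAt_def] using hy
  simp only [writtenInExtChartAt, comp_apply, extChartAt_symm_coe f M]
  rw [show Rechart.out f M (Rechart.into f M (c.symm (f.symm y))) = c.symm (f.symm y) from rfl]
  simp only [extChartAt, OpenPartialHomeomorph.extend_coe, comp_apply]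
  rw [← hc, c.right_inv hy', apply_symm_eq f L hIf]

/-- **`d(out)_p = L.symm`**: `HasMFDerivAt` form. [folklore] -/
theorem hasMFDerivAt_out [IsManifold I 1 M] (hIf : ∀ x, f x = L (I x)) (p : Rechart f M) :
    HasMFDerivAt 𝓘(𝕜, E') I (Rechart.out f M) p (L.symm : E' →L[𝕜] E) := by
  refine ⟨(continuous_out f M).continuousAt, ?_⟩
  have hev := writtenInExtChartAt_out_eventuallyEq f M L hIf p
  simp only [modelWithCornersSelf_coe, range_id, hasFDerivWithinAt_univ]
  exact (L.symm : E' →L[𝕜] E).hasFDerivAt.congr_of_eventuallyEq hev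

/-- `mfderiv` of the identity `out` is `L.symm`. [folklore] -/
theorem mfderiv_out [IsManifold I 1 M] (hIf : ∀ x, f x = L (I x)) (p : Rechart f M) :
    mfderiv 𝓘(𝕜, E') I (Rechart.out f M) p = (L.symm : E' →L[𝕜] E) :=
  (hasMFDerivAt_out f M L hIf p).mfderiv

/-- `d(out) ∘ d(into) = id` pointwise. [folklore] -/
theorem mfderiv_out_mfderiv_into [IsManifold I 1 M] (hIf : ∀ x, f x = L (I x)) (x : M)
    (v : TangentSpace I x) :
    mfderiv 𝓘(𝕜, E') I (Rechart.out f M) (Rechart.into f M x)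
      (mfderiv I 𝓘(𝕜, E') (Rechart.into f M) x v) = v := by
  rw [mfderiv_out f M L hIf, mfderiv_into f M L hIf]
  exact L.symm_apply_apply v

/-- `d(into) ∘ d(out) = id` pointwise. [folklore] -/
theorem mfderiv_into_mfderiv_out [IsManifold I 1 M] (hIf : ∀ x, f x = L (I x)) (p : Rechart f M)
    (w : TangentSpace 𝓘(𝕜, E') p) :
    mfderiv I 𝓘(𝕜, E') (Rechart.into f M) (Rechart.out f M p)
      (mfderiv 𝓘(𝕜, E') I (Rechart.out f M) p w) = w := by
  rw [mfderiv_out f M L hIf, mfderiv_into f M L hIf]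
  exact L.apply_symm_apply w

end Rechart

end Literature.Geometry.Manifold

end
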